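import Summits.CriticalPhenomena.Ising3DConformalLimit.Theses.FKParityRobustness
import Summits.CriticalPhenomena.Ising3DConformalLimit.Theorems.FKParityRobustnessIndependentStrandsJoinEventuallyUpgrade
import Summits.CriticalPhenomena.Ising3DConformalLimit.Theorems.FKParityRobustnessIndependentStrandsJoinShapeDictionary
import Summits.CriticalPhenomena.Ising3DConformalLimit.Theorems.FKParityRobustnessIndependentStrandsJoinLimitDictionary
import Summits.CriticalPhenomena.Ising3DConformalLimit.Theorems.FKParityRobustnessIndependentStrandsJoinNonGaussianResidual
import Summits.CriticalPhenomena.Ising3DConformalLimit.Theorems.FKParityRobustnessIndependentStrandsJoinShapeLoopResidual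
import Summits.CriticalPhenomena.Ising3DConformalLimit.Theorems.FKParityRobustnessJoinForcesU4
import Summits.CriticalPhenomena.Ising3DConformalLimit.Theorems.FKParityRobustnessIndependentStrandsJoinRectTransfer
import HarnessLib
import HarnessLib.Audit

/-!
# Skeleton — crux `IndependentStrandsJoin` (stmt-CriticalPhenomena-14625), line `pinch-to-tetra` (revision r7, "limit-free")

Route `FKParityRobustness`, sub-problem `Ising3DConformalLimit`.  Crux strategist `planner-cstrat-stmt-CriticalPhenomena-14625-p1-0`;
leads `…-c2-0` (r2, r3), `…-c3-0` (r3), `…-c4-0` (r4), `…-c5-0` (r5), `…-c6-0` (r6), `…-c7-0` (this revision).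

Revision r7 (2026-08-17, lead c7-0) — RESHAPE of r6 on ONE observation (kernel-checked and LANDED as
`Theorems/FKParityRobustnessIndependentStrandsJoinEventuallyUpgrade.lean`, p169300, sub-goal `stub_eventuallyUpgrade`):
in the landed composition `independentStrandsJoin_of_limit_io : LimitExists → TetraMergingIO → PerScale → crux` the existence of
the scaling limit is used for ONE step only — the upgrade `∃^∞ l ⟹ ∀ large l` (`tetraMergingEventually_of_io`); the box passage
(`boxU4Bound_of_critical`), the per-box sandwich (`jointSum_ge_of_boxU4`) and the finite minimum with the landed per-scale
constants (`Theorems.stub_perScale`) are limit-free; and r6's stub already gives `TetraMergingEventually` DIRECTLY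
(`tetraMergingEventually_of_rectDominance`, p159130) — r6 routed it through `tetraMergingIO_of_eventually` and back through the
limit.  Consequences (all landed in p169300):
* `independentStrandsJoin_of_eventually : TetraMergingEventually → PerScale → crux` — no limit;
* `independentStrandsJoin_iff_tetraMergingEventually : crux ↔ TetraMergingEventually` — UNCONDITIONAL (no limit, no covariance);
  equivalently (`independentStrandsJoin_iff_R4ratio`) `crux ↔ ∃ c > 0, ∀ large l, c ≤ R₄(A_l)`, `R₄(A_l) = −U₄crit(l·tetra)/τ_d(l)²`
  Aizenman's merging ratio: THE CRUX IS EXACTLY LATTICE HYPERSCALING AT THE REGULAR TETRAHEDRON (the dimensionless renormalised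
  coupling restricted to one shape stays bounded below) — `d = 2` proved [AizenmanCMP1982 §5, §8], `d = 4` refuted (→ 0 like
  `(log l)^{−c}`) [AizenmanDuminilCopinAnnals2021], `d = 3` open [DuminilCopinICM2022 §6.4; arXiv:2208.00864 §9: "critical
  properties of the 3D model … among the most important unsolved puzzles"]; equivalently (`…_iff_strictLebowitzTetra`) strict
  Lebowitz at the tetrahedron uniformly in the scale, `⟨σσσσ⟩(l·tetra) ≤ (3 − c)·τ_d²` (all six pair distances equal `2√2·l`);
* `independentStrandsJoin_of_rectDominance : RectDominance → crux` — UNCONDITIONAL;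
* `stub_limitExists` (items 1344/4738) LEAVES the skeleton: this crux no longer waits on the existence of the scaling limit.
r7 := {stub_rectDominance} — ONE registered stub (r6's, verbatim): the quantitative floor at the RP-DIAGONAL rectangle,
`S₄(l·rect) ≤ (3 − c)·τ_d(l)²` eventually (bootstrap `2.728`, lattice MC `≤ 2.904(4)` at every `(l, N)` measured, kit j025819/j025820;
GFF value `3.708 > 3`).  Composition: `IndependentStrandsJoin_of := independentStrandsJoin_of_rectDominance`.

CALIBRATION (kernel-checked below, all limit-free unless a limit hypothesis is displayed): `crux ↔ TME`; `RectDominance → SymDominance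
→ TME ↔ crux`; in merging units the three sufficient statements read `|U₄(rect_l)| ≥ (0.708 + c)τ_d²` (RectDominance) ⟹
`|U₄(rect_l)| + |U₄(tetra_l)| ≥ (0.708 + c)τ_d²` (SymDominance) ⟹ `|U₄(tetra_l)| ≥ c·τ_d²` (TME = crux): the two RP-diagonal floors are
QUANTITATIVE strengthenings of the crux (absolute constant `0.708 = 2^{2Δ} + (2/3)^{2Δ} − 2` at `Δ = 0.518`, the excess of the
rectangle's Wick sum over the tetrahedron's), bought for the location of the residual on an RP diagonal.  HONEST VERDICT OF THIS
REVISION: every statement sufficient for the crux that this campaign has typed (RectDominance, SymDominance, SME → TME, TNV, TNVᴹ,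
KiteComparable, touchingRigidity) is either the crux's own content — a scale-uniform LOWER bound on `|U₄|/⟨σσ⟩⟨σσ⟩` at a fixed shape
of `ℤ³` at `β_c` — or a quantitative strengthening of it; the GFF satisfies every inequality available in the tree (GKS, Lebowitz, MMS,
reflection positivity, spectral/transfer-matrix positivity, infrared bound) and violates each of these floors, so a proof needs
Ising-specific LOWER bounds on double-current intersection (Aizenman 1982's mechanism), for which no `d = 3` tool exists (even
two-point doubling `κ·τ(n) ≤ τ(2n)`, item 6150, is open).  The reduction is final bookkeeping; the residual is the open problem.

Disproof used: § A (per-scale TRUE — `stub_perScale`, inside `independentStrandsJoin_of_eventually`), § B (entered through the landed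
sandwich), § A′ (no graph-uniform constant: complied), § D (regime scan: `stub_rectDominance` false for `d ≥ 4` / `t < t_c`, where
`Q → 1`; as it must be), § C numerics (`R₄(A_l) → 0.95`, flat): consistent with `crux ↔ liminf R₄ > 0`.  Landed Negative lemmas
`GraphUniform`, `LoadBearing`: complied.  No `_false_without_` theorem exists for this crux (Disproof.lean unchanged since
2026-08-16T09:17Z); census N10 (`LimitExists` load-bearing through log-periodicity) concerned only the IO → Eventually step, which r7
no longer takes.
-/

noncomputable section

open Filter Topology Finset
open Literature.Probability.LatticeModels
open Summit.CriticalPhenomena.Ising3DConformalLimit.Theses.FKParityRobustness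
open Summit.CriticalPhenomena.Ising3DConformalLimit.FKParityRobustnessJoinForcesU4 (joinForcesU4_proof)
open Summit.CriticalPhenomena.Ising3DConformalLimit.Cruxes.ParityRobustMerging.PlaquetteXorSurgery (tetra)

namespace Summit.CriticalPhenomena.Ising3DConformalLimit.Cruxes.IndependentStrandsJoin.PinchToTetra

/-- **`rect`** — the RP-DIAGONAL RECTANGLE `((−1,−1,−1),(1,1,−1),(−1,−1,1),(1,1,1))` (`2 × 2√2`, standing on the
tetrahedron's bottom edge `{tetra 0, tetra 1}`; `l·rect = θP ∪ P` for the site mirror `θ : z ↦ −z` and the upper pair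
`P = ((−l,−l,l),(l,l,l))`; concyclic, cross-ratio `z = 1/3`). -/
abbrev rect : Fin 4 → Site 3 := ![![-1, -1, -1], ![1, 1, -1], ![-1, -1, 1], ![1, 1, 1]]

/-- **`S4rect l`** — the critical four-point function at the dilated rectangle `l·rect`. -/
abbrev S4rect (l : ℕ) : ℝ := criticalCorr 3 4 (fun i => (l : ℤ) • rect i)

/-- **`RectDominance`** — the ONE registered crux-specific statement (quantitative, lattice, one planar reflection-diagonal shape):
eventually `⟨σσσσ⟩_{β_c}(l·rect) ≤ (3 − c)·⟨σσ⟩⟨σσ⟩(l·tetra)` (`= (3 − c)·τ_d(l)²`). -/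
abbrev RectDominance : Prop :=
  ∃ c : ℝ, 0 < c ∧ ∃ l₁ : ℕ, ∀ l : ℕ, l₁ ≤ l → S4rect l ≤ (3 - c) * GGcrit l

/-- **`SymDominance`** — the SYMMETRIC-SECTOR form (weaker recorded alternative, NOT registered): eventually
`⟨σσσσ⟩(l·rect) + ⟨σσσσ⟩(l·tetra) ≤ (6 − c)·GG`, i.e. the squared OS-norm `½‖T^l(σ_P + σ_{P′})Ω‖²` of the quarter-turn-symmetric
two-spin state stays below its Gaussian value `6.708·τ_d²` by more than `0.708·τ_d²` (bootstrap `4.776`).  Sufficient for the crux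
(limit-free, below); implied by `RectDominance`. -/
abbrev SymDominance : Prop :=
  ∃ c : ℝ, 0 < c ∧ ∃ l₁ : ℕ, ∀ l : ℕ, l₁ ≤ l → S4rect l + criticalCorr 3 4 (fun i => (l : ℤ) • tetra i) ≤ (6 - c) * GGcrit l

/-- **`ShapeMergingEventually`** (SME) of r5, kept for the calibration: far merging of the critical lattice Ursell function
along ALL large dilations of SOME injective lattice 4-point shape. -/
abbrev ShapeMergingEventually : Prop :=
  ∃ c : ℝ, 0 < c ∧ ∃ a : Fin 4 → Site 3, Function.Injective a ∧ ∃ L₁ : ℕ, ∀ L : ℕ, L₁ ≤ L →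
    criticalCorr 3 4 (fun i => (L : ℤ) • a i) -
        (criticalCorr 3 2 ![(L : ℤ) • a 0, (L : ℤ) • a 1] * criticalCorr 3 2 ![(L : ℤ) • a 2, (L : ℤ) • a 3] +
          criticalCorr 3 2 ![(L : ℤ) • a 0, (L : ℤ) • a 2] * criticalCorr 3 2 ![(L : ℤ) • a 1, (L : ℤ) • a 3] +
          criticalCorr 3 2 ![(L : ℤ) • a 0, (L : ℤ) • a 3] * criticalCorr 3 2 ![(L : ℤ) • a 1, (L : ℤ) • a 2]) ≤
      -(c * (criticalCorr 3 2 ![(L : ℤ) • a 0, (L : ℤ) • a 1] * criticalCorr 3 2 ![(L : ℤ) • a 2, (L : ℤ) • a 3]))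

/-- **`ShapeTransfer`** — r5's residual (SME → TME), kept for the calibration. -/
abbrev ShapeTransfer : Prop := ShapeMergingEventually → TetraMergingEventually

/-! ### Name-keyed alias of the registered stub (the hypothesis of the composition) -/
namespace Registered

/-- Alias of `RectDominance` keyed by the stub name. -/
abbrev stub_rectDominance : Prop := RectDominance

end Registered

/-! ## Registered stub (`sorry` lives ONLY here) -/

/-- **stub_rectDominance** — the ONE statement specific to this crux in r7 (= r6's, verbatim; quantitative lattice residual; open):
for some `c > 0` and all large `l`, the critical four-point function of `ℤ³` at the `2l × 2√2·l` rectangle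
`l·((−1,−1,−1),(1,1,−1),(−1,−1,1),(1,1,1))` is at most `(3 − c)·⟨σ_{l·tetra 0}σ_{l·tetra 1}⟩⟨σ_{l·tetra 2}σ_{l·tetra 3}⟩`. -/
theorem stub_rectDominance :
    ∃ c : ℝ, 0 < c ∧ ∃ l₁ : ℕ, ∀ l : ℕ, l₁ ≤ l →
      criticalCorr 3 4 (fun i => (l : ℤ) • (![![-1, -1, -1], ![1, 1, -1], ![-1, -1, 1], ![1, 1, 1]] : Fin 4 → Site 3) i) ≤
        (3 - c) * GGcrit l := by
  sorry

/-! ## Composition: the crux BY NAME from exactly the one registered stub -/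

/-- **The line's composition (r7)**: `stub_rectDominance`, the PROVED reflection-positivity transfer `S₄(l·tetra) ≤ S₄(l·rect)`
and the PROVED limit-free upgrade (`independentStrandsJoin_of_rectDominance` = `tetraMergingEventually_of_rectDominance` then
`independentStrandsJoin_of_eventually` with the landed `stub_perScale`) give the lattice crux.  No scaling limit, no covariance. -/
theorem IndependentStrandsJoin_of (h : Registered.stub_rectDominance) :
    Summit.CriticalPhenomena.Ising3DConformalLimit.Theses.FKParityRobustness.IndependentStrandsJoin :=
  independentStrandsJoin_of_rectDominance h

/-! ### Consistency: the registered stub IS its name-keyed alias (definitionally), and the wiring -/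
example : Registered.stub_rectDominance := stub_rectDominance
example : Summit.CriticalPhenomena.Ising3DConformalLimit.Theses.FKParityRobustness.IndependentStrandsJoin :=
  IndependentStrandsJoin_of stub_rectDominance

/-! ### Calibration (kernel-checked; everything limit-free unless a limit hypothesis is displayed) -/

/-- THE CRUX IS tetrahedral far merging at all large scales (landed, p169300). -/
example : IndependentStrandsJoin ↔ TetraMergingEventually := independentStrandsJoin_iff_tetraMergingEventually
/-- THE CRUX IS lattice hyperscaling at the regular tetrahedron: `liminf`-form with Aizenman's ratio `R₄(A_l) ∈ [0,2]`. -/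
example : IndependentStrandsJoin ↔ ∃ c : ℝ, 0 < c ∧ ∃ l₁ : ℕ, ∀ l : ℕ, l₁ ≤ l → c ≤ R4ratio l :=
  independentStrandsJoin_iff_R4ratio
/-- `stub_rectDominance` gives tetrahedral far merging OUTRIGHT, hence r5's residual `ShapeTransfer` (idle antecedent). -/
example (h2 : Registered.stub_rectDominance) : TetraMergingEventually := tetraMergingEventually_of_rectDominance h2
example (h2 : Registered.stub_rectDominance) : ShapeTransfer := fun _ => tetraMergingEventually_of_rectDominance h2
/-- `RectDominance ⟹ SymDominance` (with `2c`): `R + T ≤ 2R` by the RP transfer. -/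
theorem symDominance_of_rectDominance (h : RectDominance) : SymDominance := by
  obtain ⟨c, hc, l₁, hl⟩ := h
  refine ⟨2 * c, by positivity, l₁, fun l hll => ?_⟩
  have h1 := criticalCorr_tetra_le_rect l
  have h2 := hl l hll
  simp only [S4rect] at h2 ⊢
  linarith
/-- `SymDominance ⟹ TetraMergingEventually` (with `c/2`): `T ≤ (R + T)/2 ≤ (3 − c/2)·GG` by the RP transfer, and `U₄ = T − 3·GG`. -/
theorem tetraMergingEventually_of_symDominance (h : SymDominance) : TetraMergingEventually := by
  obtain ⟨c, hc, l₁, hl⟩ := h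
  refine ⟨c / 2, by positivity, l₁, fun l hll => ?_⟩
  have h1 := criticalCorr_tetra_le_rect l
  have h2 := hl l hll
  have hw := wick_tetra_eq l
  simp only [S4rect] at h2
  unfold U4crit
  linarith
/-- Hence the weaker RP-diagonal floor ALSO gives the crux, limit-free. -/
example (h : SymDominance) : IndependentStrandsJoin :=
  independentStrandsJoin_iff_tetraMergingEventually.2 (tetraMergingEventually_of_symDominance h)
/-- ONE-WAY (honest overshoot): the crux gives `⟨σσσσ⟩(l·tetra) ≤ (3 − c)·GG` at all large scales — the same bound at the
OFF-diagonal Gram entry — and nothing about the rectangle. -/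
example : IndependentStrandsJoin ↔ ∃ c : ℝ, 0 < c ∧ ∃ l₁ : ℕ, ∀ l : ℕ, l₁ ≤ l →
    criticalCorr 3 4 (fun i => (l : ℤ) • tetra i) ≤ (3 - c) * GGcrit l :=
  independentStrandsJoin_iff_strictLebowitzTetra
/-- Through the closed bridge `JoinForcesU4` the crux implies clause (iii) (item 0636) for every limit that exists. -/
example (h : IndependentStrandsJoin) : NonGaussianLimit := joinForcesU4_proof h
/-- r5's bookkeeping stays exact: given `LimitExists` (items 1344/4738 — NOT a stub any more), the crux is
`NonGaussianLimit ∧ ShapeTransfer`. -/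
example (h1 : LimitExists) : IndependentStrandsJoin ↔ (NonGaussianLimit ∧ ShapeTransfer) :=
  independentStrandsJoin_iff_nonGaussian_and_shapeTransfer h1
/-- r4 → … → r7: `LimitExists` is implied by `MoebiusLimit` (item stmt-CriticalPhenomena-1344). -/
example (hM : MoebiusLimit) : LimitExists := limitExists_of_moebiusLimit hM

end Summit.CriticalPhenomena.Ising3DConformalLimit.Cruxes.IndependentStrandsJoin.PinchToTetra
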